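import Literature.MathematicalPhysics.QuantumFieldTheory.WilsonPartitionLaplaceForm
import Literature.Analysis.Asymptotics.SublevelMonomialization
import Literature.Analysis.Asymptotics.SublevelLocalToGlobal
import Literature.Analysis.Asymptotics.LaplacePowerLogAbelian
import HarnessLib

/-!
# `WilsonPartitionRegularVariation` from the monomialization of sublevel volumes

This file pushes the reduction of `WilsonPartitionRegularVariation` one level below
`wilsonPartitionRegularVariation_of_laplaceAsymptotics` (whose hypothesis is the whole
leading-term asymptotic theory of Laplace integrals with analytic phase, Lin 2017 Thm. 2.9 /
AGV II §7.3 Thm. 7.6): here the ONLY hypothesis left is the *output of Hironaka's embedded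
resolution of singularities in the form in which it is used for integrals* — after a partition of
unity and the change of variables along the resolution map, the `φ`-weighted sublevel volumes
`V(t) = ∫_{x ∈ Ω, |f x| ≤ t} φ dμ` of an analytic `f` over a compact semianalytic `Ω` (with
`μ(Ω ∩ f⁻¹ 0) = 0`) agree near `0⁺` with a finite sum of monomial chart pieces
`∫_{a_i(y) y^{κ_i} ≤ t} ψ_i(y) y^{w_i - 1} dy` over the unit cube (Lin 2017, Thm. 2.2 / Cor. 2.3 and
the proof of Lemma 2.4; AGV II §7.3, proof of Thm. 7.5).  Everything downstream is PROVED in the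
tree:

* the degenerate case `μ(Ω ∩ f⁻¹0) > 0` (then `∫_Ω e^{-τ|f|} φ → ∫_{Ω ∩ f⁻¹ 0} φ > 0`, exponent
  `λ = 0`): `tendsto_laplace_of_zeroSet`, by dominated convergence;
* sublevel asymptotics ⇒ Laplace asymptotics: `tendsto_laplace_of_sublevel`
  (`LaplacePowerLogAbelian`);
* monomial pieces ⇒ power-log asymptotics with `C > 0`, `λ ∈ ℚ_{>0}`, `θ ≤ d`:
  `MonomialPhase.tendsto_of_monomialPieces` (the elementary theory, AGV II §7.2 / Lin Prop. 2.1,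
  files `Monomial*.lean`, `PowerLogFiniteSum.lean`);
* hence the hypothesis of `wilsonPartitionRegularVariation_of_laplaceAsymptotics`
  (`laplaceAsymptotics_of_monomialization`) and the named fact
  (`wilsonPartitionRegularVariation_of_monomialization`);
* and one level further down: the GLOBAL decomposition itself follows (base gluing, proved in
  `SublevelLocalToGlobal`) from LOCAL monomializations at the zeros of `f` — the local output of
  Hironaka's theorem at a point, for all continuous cut-offs `σ ≥ 0` supported near it
  (`monomialization_of_local`), whence `laplaceAsymptotics_of_localMonomialization` and
  `wilsonPartitionRegularVariation_of_localMonomialization`, whose only hypothesis is that local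
  statement.

No definitions, no named facts (the resolution hypotheses are binders, stated verbatim).

## References

* S. Lin, arXiv:1003.5338, Thm. 2.2, Cor. 2.3, Lemma 2.4, Prop. 2.5, Thm. 2.9. [Lin2017]
* V. I. Arnold, S. M. Gusein-Zade, A. N. Varchenko, *Singularities of Differentiable Maps II*
  (2012), Part II §7.3 (proof of Thm. 7.5), Thm. 7.6. [ArnoldGuseinzadeVarchenko2012]
-/

noncomputable section

open MeasureTheory Filter Set Topology
open Literature.Analysis.Asymptotics Literature.Analysis.Asymptotics.MonomialPhase

open scoped ENNReal ContDiff

namespace Literature.MathematicalPhysics.QuantumFieldTheory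

section Analysis

variable {E : Type*} [NormedAddCommGroup E] [MeasurableSpace E] [BorelSpace E]
  {μ : Measure E} [IsFiniteMeasureOnCompacts μ]

/-- **Degenerate case** (`λ = 0`): for `f, φ` continuous on an open `U ⊇ Ω`, `Ω` compact,
`∫_Ω e^{-τ|f|} φ dμ → ∫_{Ω ∩ f⁻¹ 0} φ dμ` as `τ → ∞` (dominated convergence). [folklore] -/
theorem tendsto_laplace_of_zeroSet {U Ω : Set E} {f φ : E → ℝ}
    (hf : ContinuousOn f U) (hφ : ContinuousOn φ U) (hΩ : IsCompact Ω) (hΩU : Ω ⊆ U) :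
    Tendsto (fun τ : ℝ => ∫ x in Ω, Real.exp (-(τ * |f x|)) * φ x ∂μ) atTop
      (𝓝 (∫ x in {x ∈ Ω | f x = 0}, φ x ∂μ)) := by
  have hΩm : MeasurableSet Ω := hΩ.isClosed.measurableSet
  have hA : IsClosed {x ∈ Ω | f x = 0} :=
    (hf.mono hΩU).preimage_isClosed_of_isClosed hΩ.isClosed isClosed_singleton (t := {0})
  have hAm : MeasurableSet {x ∈ Ω | f x = 0} := hA.measurableSet
  have hφint : IntegrableOn φ Ω μ := (hφ.mono hΩU).integrableOn_compact hΩ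
  have hlimit : ∫ x in Ω, ({x ∈ Ω | f x = 0}).indicator φ x ∂μ = ∫ x in {x ∈ Ω | f x = 0}, φ x ∂μ := by
    rw [setIntegral_indicator hAm, inter_eq_right.2 (fun x hx => hx.1)]
  rw [← hlimit]
  refine tendsto_integral_filter_of_dominated_convergence (fun x => ‖φ x‖) ?_ ?_ hφint.norm ?_
  · refine Eventually.of_forall fun τ => ContinuousOn.aestronglyMeasurable ?_ hΩm
    exact (Real.continuous_exp.comp_continuousOn
      ((continuousOn_const.mul (continuous_abs.comp_continuousOn (hf.mono hΩU))).neg)).mul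
      (hφ.mono hΩU)
  · filter_upwards [eventually_ge_atTop (0 : ℝ)] with τ hτ
    refine ae_of_all _ fun x => ?_
    rw [norm_mul, Real.norm_eq_abs, abs_of_pos (Real.exp_pos _)]
    refine mul_le_of_le_one_left (norm_nonneg _) (Real.exp_le_one_iff.2 ?_)
    nlinarith [abs_nonneg (f x)]
  · rw [ae_restrict_iff' hΩm]
    refine ae_of_all _ fun x hx => ?_
    by_cases hfx : f x = 0
    · have hmem : x ∈ {x ∈ Ω | f x = 0} := ⟨hx, hfx⟩
      simp only [hfx, abs_zero, mul_zero, neg_zero, Real.exp_zero, one_mul, indicator_of_mem hmem]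
      exact tendsto_const_nhds
    · rw [indicator_of_notMem (fun h : x ∈ {x ∈ Ω | f x = 0} => hfx h.2)]
      have h1 : Tendsto (fun τ : ℝ => Real.exp (-(τ * |f x|))) atTop (𝓝 0) :=
        Real.tendsto_exp_atBot.comp
          (tendsto_neg_atTop_atBot.comp (tendsto_id.atTop_mul_const (abs_pos.2 hfx)))
      simpa using h1.mul_const (φ x)

/-- **Sublevel asymptotics ⇒ Laplace asymptotics** in the geometric setting: if
`∫_{x ∈ Ω, |f x| ≤ t} φ dμ / (t^λ (log 1/t)^m) → C` as `t → 0⁺` then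
`τ^λ (log τ)^{-m} ∫_Ω e^{-τ|f|} φ dμ → C Γ(λ+1)` (`f, φ` continuous on an open `U ⊇ Ω`, `Ω`
compact, `φ ≥ 0` on `Ω`; Abelian theorem of `LaplacePowerLogAbelian`).
[cite: ArnoldGuseinzadeVarchenko2012, Part II §7.2 Thm. 7.3] -/
theorem tendsto_laplace_of_sublevel {U Ω : Set E} {f φ : E → ℝ} (hU : IsOpen U)
    (hf : ContinuousOn f U) (hφ : ContinuousOn φ U) (hΩ : IsCompact Ω) (hΩU : Ω ⊆ U)
    (hφ0 : ∀ x ∈ Ω, 0 ≤ φ x) {C lam : ℝ} {m : ℕ} (hlam : 0 ≤ lam)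
    (hV : Tendsto (fun t : ℝ => (∫ x in {x ∈ Ω | |f x| ≤ t}, φ x ∂μ) /
      (t ^ lam * Real.log t⁻¹ ^ m)) (𝓝[>] 0) (𝓝 C)) :
    Tendsto (fun τ : ℝ => τ ^ lam / Real.log τ ^ m * ∫ x in Ω, Real.exp (-(τ * |f x|)) * φ x ∂μ)
      atTop (𝓝 (C * Real.Gamma (lam + 1))) := by
  classical
  have hΩm : MeasurableSet Ω := hΩ.isClosed.measurableSet
  -- measurable modifications of `|f|` and `φ` (they are only continuous on `U`)
  set S : E → ℝ := U.piecewise (fun x => |f x|) 0 with hSdef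
  set φ' : E → ℝ := U.piecewise φ 0 with hφ'def
  have hSm : Measurable S := ContinuousOn.measurable_piecewise
    (continuous_abs.comp_continuousOn hf) continuousOn_const hU.measurableSet
  have hφ'm : Measurable φ' :=
    ContinuousOn.measurable_piecewise hφ continuousOn_const hU.measurableSet
  have hSΩ : ∀ x ∈ Ω, S x = |f x| := fun x hx => piecewise_eq_of_mem _ _ _ (hΩU hx)
  have hφ'Ω : ∀ x ∈ Ω, φ' x = φ x := fun x hx => piecewise_eq_of_mem _ _ _ (hΩU hx)
  have hS0 : ∀ x, 0 ≤ S x := by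
    intro x
    by_cases hx : x ∈ U
    · rw [hSdef, piecewise_eq_of_mem _ _ _ hx]
      exact abs_nonneg _
    · rw [hSdef, piecewise_eq_of_notMem _ _ _ hx, Pi.zero_apply]
  have hφint : IntegrableOn φ Ω μ := (hφ.mono hΩU).integrableOn_compact hΩ
  have hφ'int : IntegrableOn φ' Ω μ := hφint.congr_fun (fun x hx => (hφ'Ω x hx).symm) hΩm
  -- the finite measure `φ · μ|_Ω`
  set ν : Measure E := (μ.restrict Ω).withDensity fun x => ENNReal.ofReal (φ' x) with hν
  haveI : IsFiniteMeasure ν := isFiniteMeasure_withDensity_ofReal hφ'int.hasFiniteIntegral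
  -- its sublevel volumes
  have hsub : ∀ t, (ν {x | S x ≤ t}).toReal = ∫ x in {x ∈ Ω | |f x| ≤ t}, φ x ∂μ := by
    intro t
    have hm : MeasurableSet {x | S x ≤ t} := measurableSet_le hSm measurable_const
    have hset : {x | S x ≤ t} ∩ Ω = {x ∈ Ω | |f x| ≤ t} := by
      ext x
      constructor
      · rintro ⟨h1, h2⟩
        refine ⟨h2, ?_⟩
        have h1' : S x ≤ t := h1
        rwa [hSΩ x h2] at h1'
      · rintro ⟨h1, h2⟩
        refine ⟨?_, h1⟩
        show S x ≤ t
        rwa [hSΩ x h1]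
    have hsubset : {x ∈ Ω | |f x| ≤ t} ⊆ Ω := fun x hx => hx.1
    have hmeas' : MeasurableSet {x ∈ Ω | |f x| ≤ t} := by
      rw [← hset]
      exact hm.inter hΩm
    rw [hν, withDensity_apply _ hm, Measure.restrict_restrict hm, hset]
    have hint' : IntegrableOn φ' {x ∈ Ω | |f x| ≤ t} μ := hφ'int.mono_set hsubset
    have hnn : 0 ≤ᵐ[μ.restrict {x ∈ Ω | |f x| ≤ t}] φ' := by
      rw [EventuallyLE, ae_restrict_iff' hmeas']
      exact ae_of_all _ fun x hx => by rw [Pi.zero_apply, hφ'Ω x hx.1]; exact hφ0 x hx.1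
    rw [← ofReal_integral_eq_lintegral_ofReal hint' hnn,
      ENNReal.toReal_ofReal (integral_nonneg_of_ae hnn)]
    exact setIntegral_congr_fun hmeas' fun x hx => hφ'Ω x hx.1
  -- its Laplace transforms
  have hlap : ∀ τ : ℝ, ∫ x, Real.exp (-(τ * S x)) ∂ν =
      ∫ x in Ω, Real.exp (-(τ * |f x|)) * φ x ∂μ := by
    intro τ
    rw [hν, integral_withDensity_eq_integral_toReal_smul hφ'm.ennreal_ofReal
      (ae_of_all _ fun x => ENNReal.ofReal_lt_top)]
    refine setIntegral_congr_fun hΩm fun x hx => ?_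
    rw [hφ'Ω x hx, ENNReal.toReal_ofReal (hφ0 x hx), hSΩ x hx, smul_eq_mul, mul_comm]
  have hV' : Tendsto (fun t : ℝ => (ν {x | S x ≤ t}).toReal / (t ^ lam * Real.log t⁻¹ ^ m))
      (𝓝[>] 0) (𝓝 C) := by
    simp_rw [hsub]
    exact hV
  have h := LaplacePowerLog.tendsto_laplace_mul_rpow_div_log_pow (μ := ν) hSm hS0 hlam hV'
  refine h.congr' (Eventually.of_forall fun τ => ?_)
  rw [hlap τ]
  ring

/-- **Positivity of the sublevel integrals at an interior zero**: if `f(x₀) = 0` at an interior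
point `x₀` of `Ω`, `f, φ` are continuous on an open `U ⊇ Ω` and `φ(x₀) > 0`, `φ ≥ 0` on `Ω`,
then `∫_{x ∈ Ω, |f x| ≤ t} φ dμ > 0` for every `t > 0` (`μ` positive on open sets). [folklore] -/
theorem setIntegral_sublevel_pos [μ.IsOpenPosMeasure] {U Ω : Set E} {f φ : E → ℝ}
    (hU : IsOpen U) (hf : ContinuousOn f U) (hφ : ContinuousOn φ U) (hΩ : IsCompact Ω)
    (hΩU : Ω ⊆ U) (hφ0 : ∀ x ∈ Ω, 0 ≤ φ x) {x₀ : E} (hx₀ : x₀ ∈ interior Ω) (hfx₀ : f x₀ = 0)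
    (hφx₀ : 0 < φ x₀) {t : ℝ} (ht : 0 < t) :
    0 < ∫ x in {x ∈ Ω | |f x| ≤ t}, φ x ∂μ := by
  have hΩm : MeasurableSet Ω := hΩ.isClosed.measurableSet
  have hx₀Ω : x₀ ∈ Ω := interior_subset hx₀
  have hx₀U : x₀ ∈ U := hΩU hx₀Ω
  have hfc : ContinuousAt f x₀ := hf.continuousAt (hU.mem_nhds hx₀U)
  have hφc : ContinuousAt φ x₀ := hφ.continuousAt (hU.mem_nhds hx₀U)
  -- a ball inside `Ω` on which `|f| < t` and `φ > φ(x₀)/2`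
  have h1 : ∀ᶠ x in 𝓝 x₀, |f x| < t := by
    have := hfc.tendsto
    rw [hfx₀] at this
    have h := (continuous_abs.tendsto 0).comp this
    simp only [abs_zero] at h
    exact h.eventually (gt_mem_nhds ht)
  have h2 : ∀ᶠ x in 𝓝 x₀, φ x₀ / 2 < φ x := hφc.eventually (lt_mem_nhds (by linarith))
  have h3 : ∀ᶠ x in 𝓝 x₀, x ∈ interior Ω := isOpen_interior.mem_nhds hx₀
  obtain ⟨r, hr, hball⟩ := Metric.eventually_nhds_iff_ball.1 (h1.and (h2.and h3))
  have hBsub : Metric.ball x₀ r ⊆ {x ∈ Ω | |f x| ≤ t} := fun x hx =>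
    ⟨interior_subset (hball x hx).2.2, (hball x hx).1.le⟩
  have hmeas : MeasurableSet {x ∈ Ω | |f x| ≤ t} := by
    have hc : IsClosed {x ∈ Ω | |f x| ≤ t} :=
      (continuous_abs.comp_continuousOn (hf.mono hΩU)).preimage_isClosed_of_isClosed
        hΩ.isClosed isClosed_Iic (t := Iic t)
    exact hc.measurableSet
  have hφint : IntegrableOn φ Ω μ := (hφ.mono hΩU).integrableOn_compact hΩ
  have hint : IntegrableOn φ {x ∈ Ω | |f x| ≤ t} μ := hφint.mono_set fun x hx => hx.1
  calc (0 : ℝ) < μ.real (Metric.ball x₀ r) • (φ x₀ / 2) := by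
        refine smul_pos ?_ (by linarith)
        exact ENNReal.toReal_pos (Metric.isOpen_ball.measure_pos μ ⟨x₀, Metric.mem_ball_self hr⟩).ne'
          (measure_ne_top_of_subset (hBsub.trans fun x hx => hx.1) (hΩ.measure_lt_top).ne)
    _ ≤ ∫ x in Metric.ball x₀ r, φ x ∂μ :=
        setIntegral_ge_of_const_le measurableSet_ball
          (measure_ne_top_of_subset (hBsub.trans fun x hx => hx.1) (hΩ.measure_lt_top).ne)
          (fun x hx => (hball x hx).2.1.le) (hint.mono_set hBsub)
    _ ≤ ∫ x in {x ∈ Ω | |f x| ≤ t}, φ x ∂μ :=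
        setIntegral_mono_set hint
          ((ae_restrict_iff' hmeas).2 (ae_of_all _ fun x hx => hφ0 x hx.1))
          (Eventually.of_forall hBsub)

end Analysis

section Main

/-- **Leading-term asymptotics of Laplace integrals with analytic phase, from the monomialization
of sublevel volumes.** The hypothesis `hR` is the output of Hironaka's embedded resolution of
singularities in the form in which it is used for integrals (Lin 2017, Thm. 2.2 / Cor. 2.3 with
the partition of unity and change of variables of the proof of Lemma 2.4; AGV II §7.3, proof of
Thm. 7.5): when `μ(Ω ∩ f⁻¹ 0) = 0`, the `φ`-weighted sublevel volumes of `|f|` over the compact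
semianalytic `Ω = {x ∈ U : gⱼ ≥ 0}` agree near `0⁺` with a finite sum of monomial chart pieces
(exponents `κ_i ≠ 0`, natural weights `w_i ≥ 1`, continuous units `a_i > 0`, continuous
amplitudes `ψ_i ≥ 0` on the unit cube, positive at its origin). It is NOT proved in the tree. The
conclusion is the (corrected, `λ ≥ 0`) hypothesis of
`wilsonPartitionRegularVariation_of_laplaceAsymptotics`; the degenerate case `μ(Ω ∩ f⁻¹0) > 0`
gives `λ = 0` and needs no resolution. [cite: Lin2017, Thm. 2.2, Cor. 2.3, Lemma 2.4, Prop. 2.5,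
Thm. 2.9] [cite: ArnoldGuseinzadeVarchenko2012, Part II §7.3] -/
theorem laplaceAsymptotics_of_monomialization
    (hR : ∀ (E : Type) [NormedAddCommGroup E] [NormedSpace ℝ E] [FiniteDimensional ℝ E]
      [MeasurableSpace E] [BorelSpace E] (μ : Measure E) [μ.IsAddHaarMeasure],
      ∀ (U : Set E) (f : E → ℝ) (l : ℕ) (g : Fin l → E → ℝ) (φ : E → ℝ),
        IsOpen U → AnalyticOnNhd ℝ f U → (∀ j, AnalyticOnNhd ℝ (g j) U) → ContDiffOn ℝ ∞ φ U →
        IsCompact {x ∈ U | ∀ j, 0 ≤ g j x} → (∀ x ∈ {x ∈ U | ∀ j, 0 ≤ g j x}, 0 < φ x) →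
        μ {x ∈ U | (∀ j, 0 ≤ g j x) ∧ f x = 0} = 0 →
        ∃ (ι : Type) (_ : Fintype ι) (κ w : ι → Fin (Module.finrank ℝ E) → ℕ)
          (a ψ : ι → (Fin (Module.finrank ℝ E) → ℝ) → ℝ) (t₀ : ℝ),
          (∀ i, κ i ≠ 0) ∧ (∀ i j, 0 < w i j) ∧ (∀ i, Continuous (a i)) ∧ (∀ i x, 0 < a i x) ∧
          (∀ i, Continuous (ψ i)) ∧
          (∀ i, ∀ x ∈ Icc (0 : Fin (Module.finrank ℝ E) → ℝ) 1, 0 ≤ ψ i x) ∧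
          (∀ i, 0 < ψ i 0) ∧ 0 < t₀ ∧
          ∀ t ∈ Ioo (0 : ℝ) t₀, ∫ x in {x ∈ U | (∀ j, 0 ≤ g j x) ∧ |f x| ≤ t}, φ x ∂μ =
            ∑ i, ∫ y in {y : Fin (Module.finrank ℝ E) → ℝ | a i y * ∏ j, y j ^ κ i j ≤ t},
              ψ i y ∂(Measure.pi fun j => powMeasure (w i j : ℝ))) :
    ∀ (E : Type) [NormedAddCommGroup E] [NormedSpace ℝ E] [FiniteDimensional ℝ E]
      [MeasurableSpace E] [BorelSpace E] (μ : Measure E) [μ.IsAddHaarMeasure],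
      0 < Module.finrank ℝ E →
      ∀ (U : Set E) (f : E → ℝ) (l : ℕ) (g : Fin l → E → ℝ) (φ : E → ℝ),
        IsOpen U → AnalyticOnNhd ℝ f U → (∀ j, AnalyticOnNhd ℝ (g j) U) → ContDiffOn ℝ ∞ φ U →
        IsCompact {x ∈ U | ∀ j, 0 ≤ g j x} → (∀ x ∈ {x ∈ U | ∀ j, 0 ≤ g j x}, 0 < φ x) →
        (∃ x₀ ∈ interior {x ∈ U | ∀ j, 0 ≤ g j x}, f x₀ = 0) →
        ∃ (C : ℝ) (lam : ℚ) (m : ℕ), 0 < C ∧ 0 ≤ lam ∧ m < Module.finrank ℝ E ∧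
          Tendsto (fun τ : ℝ => τ ^ (lam : ℝ) / Real.log τ ^ m *
              ∫ x in {x ∈ U | ∀ j, 0 ≤ g j x}, Real.exp (-(τ * |f x|)) * φ x ∂μ)
            atTop (𝓝 C) := by
  intro E _ _ _ _ _ μ _ hd U f l g φ hU hf hg hφ hΩ hφpos hzero
  obtain ⟨x₀, hx₀, hfx₀⟩ := hzero
  set Ω : Set E := {x ∈ U | ∀ j, 0 ≤ g j x} with hΩdef
  have hΩU : Ω ⊆ U := fun x hx => hx.1
  have hfc : ContinuousOn f U := hf.continuousOn
  have hφc : ContinuousOn φ U := hφ.continuousOn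
  have hφ0 : ∀ x ∈ Ω, 0 ≤ φ x := fun x hx => (hφpos x hx).le
  have hAeq : {x ∈ U | (∀ j, 0 ≤ g j x) ∧ f x = 0} = {x ∈ Ω | f x = 0} := by
    ext x
    simp only [hΩdef, mem_setOf_eq, and_assoc]
  have hVeq : ∀ t : ℝ, {x ∈ U | (∀ j, 0 ≤ g j x) ∧ |f x| ≤ t} = {x ∈ Ω | |f x| ≤ t} := by
    intro t
    ext x
    simp only [hΩdef, mem_setOf_eq, and_assoc]
  by_cases hA : μ {x ∈ U | (∀ j, 0 ≤ g j x) ∧ f x = 0} = 0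
  · -- non-degenerate case: monomialization of the sublevel volumes
    obtain ⟨ι, _, κ, w, a, ψ, t₀, hκ, hw, ha, ha0, hψc, hψ0, hψpos, ht₀, hV⟩ :=
      hR E μ U f l g φ hU hf hg hφ hΩ hφpos hA
    -- the family of pieces is non-empty, because the sublevel integrals are positive
    haveI : Nonempty ι := by
      by_contra hι
      haveI : IsEmpty ι := not_nonempty_iff.1 hι
      have h1 := hV (t₀ / 2) ⟨by linarith, by linarith⟩
      rw [hVeq, Finset.univ_eq_empty, Finset.sum_empty] at h1
      have h2 := setIntegral_sublevel_pos (μ := μ) hU hfc hφc hΩ hΩU hφ0 hx₀ hfx₀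
        (hφpos x₀ (interior_subset hx₀)) (half_pos ht₀)
      linarith
    obtain ⟨C, lam, θ, hC, hlam, hθ1, hθd, hlim⟩ := tendsto_of_monomialPieces κ w a ψ hκ hw
      ha ha0 hψc hψ0 hψpos (V := fun t => ∫ x in {x ∈ Ω | |f x| ≤ t}, φ x ∂μ) ht₀
      (fun t ht1 ht2 => by
        show ∫ x in {x ∈ Ω | |f x| ≤ t}, φ x ∂μ = _
        rw [← hVeq]
        exact hV t ⟨ht1, ht2⟩)
    have hlap := tendsto_laplace_of_sublevel (μ := μ) hU hfc hφc hΩ hΩU hφ0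
      (show (0 : ℝ) ≤ (lam : ℝ) by exact_mod_cast hlam.le) hlim
    refine ⟨C * Real.Gamma ((lam : ℝ) + 1), lam, θ - 1,
      mul_pos hC (Real.Gamma_pos_of_pos (by positivity)), hlam.le, by omega, hlap⟩
  · -- degenerate case: `λ = 0`, no resolution needed
    have hApos : 0 < μ {x ∈ Ω | f x = 0} := by
      rw [← hAeq]
      exact pos_iff_ne_zero.2 hA
    have hAc : IsClosed {x ∈ Ω | f x = 0} :=
      (hfc.mono hΩU).preimage_isClosed_of_isClosed hΩ.isClosed isClosed_singleton (t := {0})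
    have hint : IntegrableOn φ {x ∈ Ω | f x = 0} μ :=
      ((hφc.mono hΩU).integrableOn_compact hΩ).mono_set fun x hx => hx.1
    have hV₀ : 0 < ∫ x in {x ∈ Ω | f x = 0}, φ x ∂μ := by
      rw [setIntegral_pos_iff_support_of_nonneg_ae]
      · have h : Function.support φ ∩ {x ∈ Ω | f x = 0} = {x ∈ Ω | f x = 0} :=
          inter_eq_right.2 fun x hx => Function.mem_support.2 (hφpos x hx.1).ne'
        rwa [h]
      · rw [EventuallyLE, ae_restrict_iff' hAc.measurableSet]
        exact ae_of_all _ fun x hx => hφ0 x hx.1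
      · exact hint
    refine ⟨∫ x in {x ∈ Ω | f x = 0}, φ x ∂μ, 0, 0, hV₀, le_rfl, hd, ?_⟩
    have h := tendsto_laplace_of_zeroSet (μ := μ) hfc hφc hΩ hΩU
    refine h.congr' (Eventually.of_forall fun τ => ?_)
    simp

/-- **`WilsonPartitionRegularVariation` from the monomialization of sublevel volumes**
(Hironaka's theorem in the form used for integrals; see
`laplaceAsymptotics_of_monomialization` for the precise hypothesis, which is NOT proved in the
tree). Everything else — the reduction of the compact-group Haar integral to a Laplace integral
with analytic phase over a compact semianalytic set (`WilsonPartitionLaplaceForm`), the elementary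
monomial asymptotics with amplitude and unit (`Monomial*`), the gluing bookkeeping
(`PowerLogFiniteSum`, `SublevelMonomialization`) and the Abelian theorem
(`LaplacePowerLogAbelian`) — is proved. [cite: Lin2017, Thm. 2.2, Cor. 2.3, Lemma 2.4, Thm. 2.9]
[cite: ArnoldGuseinzadeVarchenko2012, Part II §7.3 Thm. 7.5, Thm. 7.6] -/
theorem wilsonPartitionRegularVariation_of_monomialization
    (hR : ∀ (E : Type) [NormedAddCommGroup E] [NormedSpace ℝ E] [FiniteDimensional ℝ E]
      [MeasurableSpace E] [BorelSpace E] (μ : Measure E) [μ.IsAddHaarMeasure],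
      ∀ (U : Set E) (f : E → ℝ) (l : ℕ) (g : Fin l → E → ℝ) (φ : E → ℝ),
        IsOpen U → AnalyticOnNhd ℝ f U → (∀ j, AnalyticOnNhd ℝ (g j) U) → ContDiffOn ℝ ∞ φ U →
        IsCompact {x ∈ U | ∀ j, 0 ≤ g j x} → (∀ x ∈ {x ∈ U | ∀ j, 0 ≤ g j x}, 0 < φ x) →
        μ {x ∈ U | (∀ j, 0 ≤ g j x) ∧ f x = 0} = 0 →
        ∃ (ι : Type) (_ : Fintype ι) (κ w : ι → Fin (Module.finrank ℝ E) → ℕ)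
          (a ψ : ι → (Fin (Module.finrank ℝ E) → ℝ) → ℝ) (t₀ : ℝ),
          (∀ i, κ i ≠ 0) ∧ (∀ i j, 0 < w i j) ∧ (∀ i, Continuous (a i)) ∧ (∀ i x, 0 < a i x) ∧
          (∀ i, Continuous (ψ i)) ∧
          (∀ i, ∀ x ∈ Icc (0 : Fin (Module.finrank ℝ E) → ℝ) 1, 0 ≤ ψ i x) ∧
          (∀ i, 0 < ψ i 0) ∧ 0 < t₀ ∧
          ∀ t ∈ Ioo (0 : ℝ) t₀, ∫ x in {x ∈ U | (∀ j, 0 ≤ g j x) ∧ |f x| ≤ t}, φ x ∂μ =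
            ∑ i, ∫ y in {y : Fin (Module.finrank ℝ E) → ℝ | a i y * ∏ j, y j ^ κ i j ≤ t},
              ψ i y ∂(Measure.pi fun j => powMeasure (w i j : ℝ))) :
    WilsonPartitionRegularVariation :=
  wilsonPartitionRegularVariation_of_laplaceAsymptotics (laplaceAsymptotics_of_monomialization hR)

end Main

section Local

/-- **Global monomialization from local monomializations at the zeros** (the base gluing,
proved in `SublevelLocalToGlobal`): the hypothesis `hH` is the LOCAL output of Hironaka's
embedded resolution at a zero `x ∈ Ω` of `f` (Lin 2017, Thm. 2.2 / Cor. 2.3 as used in the proof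
of Lemma 2.4): a neighbourhood `W ∋ x` over which, for every continuous `σ ≥ 0` supported in `W`,
the `σφ`-weighted sublevel integrals of `|f|` on `Ω` decompose into finitely many monomial chart
pieces `∫_{a_k(y) y^{κ_k} ≤ t} σ(P_k y) ψ_k(y) y^{w_k-1} dy` (`P_k` = the resolution map in the
coordinates of the `k`-th chart, continuous with `P_k(0) = x`; `ψ_k ≥ 0` continuous, positive at
the origin; units `a_k > 0`). It is NOT proved in the tree; the conclusion is the hypothesis of
`laplaceAsymptotics_of_monomialization`. [cite: Lin2017, Thm. 2.2, Cor. 2.3, Lemma 2.4, Prop. 2.5]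
[cite: ArnoldGuseinzadeVarchenko2012, Part II §7.3] -/
theorem monomialization_of_local
    (hH : ∀ (E : Type) [NormedAddCommGroup E] [NormedSpace ℝ E] [FiniteDimensional ℝ E]
      [MeasurableSpace E] [BorelSpace E] (μ : Measure E) [μ.IsAddHaarMeasure],
      ∀ (U : Set E) (f : E → ℝ) (l : ℕ) (g : Fin l → E → ℝ) (φ : E → ℝ),
        IsOpen U → AnalyticOnNhd ℝ f U → (∀ j, AnalyticOnNhd ℝ (g j) U) → ContDiffOn ℝ ∞ φ U →
        IsCompact {x ∈ U | ∀ j, 0 ≤ g j x} → (∀ x ∈ {x ∈ U | ∀ j, 0 ≤ g j x}, 0 < φ x) →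
        μ {x ∈ U | (∀ j, 0 ≤ g j x) ∧ f x = 0} = 0 →
        ∀ x ∈ {x ∈ U | ∀ j, 0 ≤ g j x}, f x = 0 → ∃ W : Set E, IsOpen W ∧ x ∈ W ∧
          ∃ (ι : Type) (_ : Fintype ι) (κ w : ι → Fin (Module.finrank ℝ E) → ℕ)
            (a ψ : ι → (Fin (Module.finrank ℝ E) → ℝ) → ℝ)
            (P : ι → (Fin (Module.finrank ℝ E) → ℝ) → E),
            (∀ k, κ k ≠ 0) ∧ (∀ k j, 0 < w k j) ∧ (∀ k, Continuous (a k)) ∧ (∀ k y, 0 < a k y) ∧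
            (∀ k, Continuous (ψ k)) ∧
            (∀ k, ∀ y ∈ Icc (0 : Fin (Module.finrank ℝ E) → ℝ) 1, 0 ≤ ψ k y) ∧
            (∀ k, 0 < ψ k 0) ∧ (∀ k, Continuous (P k)) ∧ (∀ k, P k 0 = x) ∧
            ∀ σ : E → ℝ, Continuous σ → tsupport σ ⊆ W → (∀ z, 0 ≤ σ z) → ∀ t : ℝ, 0 < t →
              ∫ z in {z ∈ {x ∈ U | ∀ j, 0 ≤ g j x} | |f z| ≤ t}, σ z * φ z ∂μ =
                ∑ k, ∫ y in {y : Fin (Module.finrank ℝ E) → ℝ | a k y * ∏ j, y j ^ κ k j ≤ t},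
                  σ (P k y) * ψ k y ∂(Measure.pi fun j => powMeasure (w k j : ℝ))) :
    ∀ (E : Type) [NormedAddCommGroup E] [NormedSpace ℝ E] [FiniteDimensional ℝ E]
      [MeasurableSpace E] [BorelSpace E] (μ : Measure E) [μ.IsAddHaarMeasure],
      ∀ (U : Set E) (f : E → ℝ) (l : ℕ) (g : Fin l → E → ℝ) (φ : E → ℝ),
        IsOpen U → AnalyticOnNhd ℝ f U → (∀ j, AnalyticOnNhd ℝ (g j) U) → ContDiffOn ℝ ∞ φ U →
        IsCompact {x ∈ U | ∀ j, 0 ≤ g j x} → (∀ x ∈ {x ∈ U | ∀ j, 0 ≤ g j x}, 0 < φ x) →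
        μ {x ∈ U | (∀ j, 0 ≤ g j x) ∧ f x = 0} = 0 →
        ∃ (ι : Type) (_ : Fintype ι) (κ w : ι → Fin (Module.finrank ℝ E) → ℕ)
          (a ψ : ι → (Fin (Module.finrank ℝ E) → ℝ) → ℝ) (t₀ : ℝ),
          (∀ i, κ i ≠ 0) ∧ (∀ i j, 0 < w i j) ∧ (∀ i, Continuous (a i)) ∧ (∀ i x, 0 < a i x) ∧
          (∀ i, Continuous (ψ i)) ∧
          (∀ i, ∀ x ∈ Icc (0 : Fin (Module.finrank ℝ E) → ℝ) 1, 0 ≤ ψ i x) ∧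
          (∀ i, 0 < ψ i 0) ∧ 0 < t₀ ∧
          ∀ t ∈ Ioo (0 : ℝ) t₀, ∫ x in {x ∈ U | (∀ j, 0 ≤ g j x) ∧ |f x| ≤ t}, φ x ∂μ =
            ∑ i, ∫ y in {y : Fin (Module.finrank ℝ E) → ℝ | a i y * ∏ j, y j ^ κ i j ≤ t},
              ψ i y ∂(Measure.pi fun j => powMeasure (w i j : ℝ)) := by
  intro E _ _ _ _ _ μ _ U f l g φ hU hf hg hφ hΩ hφpos hA
  obtain ⟨ι, hι, κ, w, a, ψ, t₀, h1, h2, h3, h4, h5, h6, h7, h8, h9⟩ :=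
    exists_monomialPieces_of_local (μ := μ) (d := Module.finrank ℝ E) hU hf.continuousOn
      hφ.continuousOn hΩ (fun x hx => hx.1) (hH E μ U f l g φ hU hf hg hφ hΩ hφpos hA)
  refine ⟨ι, hι, κ, w, a, ψ, t₀, h1, h2, h3, h4, h5, h6, h7, h8, fun t ht => ?_⟩
  have hset : {z ∈ U | (∀ j, 0 ≤ g j z) ∧ |f z| ≤ t} =
      {z ∈ {x ∈ U | ∀ j, 0 ≤ g j x} | |f z| ≤ t} := by
    ext z
    simp only [mem_setOf_eq, and_assoc]
  rw [hset]
  exact h9 t ht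

/-- **Leading-term Laplace asymptotics from LOCAL monomializations at the zeros** (see
`monomialization_of_local` and `laplaceAsymptotics_of_monomialization`).
[cite: Lin2017, Thm. 2.2, Cor. 2.3, Lemma 2.4, Prop. 2.5, Thm. 2.9] -/
theorem laplaceAsymptotics_of_localMonomialization
    (hH : ∀ (E : Type) [NormedAddCommGroup E] [NormedSpace ℝ E] [FiniteDimensional ℝ E]
      [MeasurableSpace E] [BorelSpace E] (μ : Measure E) [μ.IsAddHaarMeasure],
      ∀ (U : Set E) (f : E → ℝ) (l : ℕ) (g : Fin l → E → ℝ) (φ : E → ℝ),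
        IsOpen U → AnalyticOnNhd ℝ f U → (∀ j, AnalyticOnNhd ℝ (g j) U) → ContDiffOn ℝ ∞ φ U →
        IsCompact {x ∈ U | ∀ j, 0 ≤ g j x} → (∀ x ∈ {x ∈ U | ∀ j, 0 ≤ g j x}, 0 < φ x) →
        μ {x ∈ U | (∀ j, 0 ≤ g j x) ∧ f x = 0} = 0 →
        ∀ x ∈ {x ∈ U | ∀ j, 0 ≤ g j x}, f x = 0 → ∃ W : Set E, IsOpen W ∧ x ∈ W ∧
          ∃ (ι : Type) (_ : Fintype ι) (κ w : ι → Fin (Module.finrank ℝ E) → ℕ)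
            (a ψ : ι → (Fin (Module.finrank ℝ E) → ℝ) → ℝ)
            (P : ι → (Fin (Module.finrank ℝ E) → ℝ) → E),
            (∀ k, κ k ≠ 0) ∧ (∀ k j, 0 < w k j) ∧ (∀ k, Continuous (a k)) ∧ (∀ k y, 0 < a k y) ∧
            (∀ k, Continuous (ψ k)) ∧
            (∀ k, ∀ y ∈ Icc (0 : Fin (Module.finrank ℝ E) → ℝ) 1, 0 ≤ ψ k y) ∧
            (∀ k, 0 < ψ k 0) ∧ (∀ k, Continuous (P k)) ∧ (∀ k, P k 0 = x) ∧
            ∀ σ : E → ℝ, Continuous σ → tsupport σ ⊆ W → (∀ z, 0 ≤ σ z) → ∀ t : ℝ, 0 < t →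
              ∫ z in {z ∈ {x ∈ U | ∀ j, 0 ≤ g j x} | |f z| ≤ t}, σ z * φ z ∂μ =
                ∑ k, ∫ y in {y : Fin (Module.finrank ℝ E) → ℝ | a k y * ∏ j, y j ^ κ k j ≤ t},
                  σ (P k y) * ψ k y ∂(Measure.pi fun j => powMeasure (w k j : ℝ))) :
    ∀ (E : Type) [NormedAddCommGroup E] [NormedSpace ℝ E] [FiniteDimensional ℝ E]
      [MeasurableSpace E] [BorelSpace E] (μ : Measure E) [μ.IsAddHaarMeasure],
      0 < Module.finrank ℝ E →
      ∀ (U : Set E) (f : E → ℝ) (l : ℕ) (g : Fin l → E → ℝ) (φ : E → ℝ),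
        IsOpen U → AnalyticOnNhd ℝ f U → (∀ j, AnalyticOnNhd ℝ (g j) U) → ContDiffOn ℝ ∞ φ U →
        IsCompact {x ∈ U | ∀ j, 0 ≤ g j x} → (∀ x ∈ {x ∈ U | ∀ j, 0 ≤ g j x}, 0 < φ x) →
        (∃ x₀ ∈ interior {x ∈ U | ∀ j, 0 ≤ g j x}, f x₀ = 0) →
        ∃ (C : ℝ) (lam : ℚ) (m : ℕ), 0 < C ∧ 0 ≤ lam ∧ m < Module.finrank ℝ E ∧
          Tendsto (fun τ : ℝ => τ ^ (lam : ℝ) / Real.log τ ^ m *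
              ∫ x in {x ∈ U | ∀ j, 0 ≤ g j x}, Real.exp (-(τ * |f x|)) * φ x ∂μ)
            atTop (𝓝 C) :=
  laplaceAsymptotics_of_monomialization (monomialization_of_local hH)

/-- **`WilsonPartitionRegularVariation` from local monomializations at the zeros of the phase**
— the named fact reduced to the local output of Hironaka's embedded resolution of singularities
for real-analytic functions (Lin 2017 Thm. 2.2 / Cor. 2.3 in the form used in the proof of
Lemma 2.4), everything else being proved in the tree: reduction of the Haar integral to a Laplace
integral with analytic phase (`WilsonPartitionLaplaceForm`), elementary monomial asymptotics with
amplitude and unit (`Monomial*`), base gluing (`SublevelLocalToGlobal`), dominant-scale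
bookkeeping (`PowerLogFiniteSum`, `SublevelMonomialization`), the degenerate case and the Abelian
theorem (`LaplacePowerLogAbelian`). [cite: Lin2017, Thm. 2.2, Cor. 2.3, Lemma 2.4, Thm. 2.9]
[cite: ArnoldGuseinzadeVarchenko2012, Part II §7.3 Thm. 7.5, Thm. 7.6] -/
theorem wilsonPartitionRegularVariation_of_localMonomialization
    (hH : ∀ (E : Type) [NormedAddCommGroup E] [NormedSpace ℝ E] [FiniteDimensional ℝ E]
      [MeasurableSpace E] [BorelSpace E] (μ : Measure E) [μ.IsAddHaarMeasure],
      ∀ (U : Set E) (f : E → ℝ) (l : ℕ) (g : Fin l → E → ℝ) (φ : E → ℝ),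
        IsOpen U → AnalyticOnNhd ℝ f U → (∀ j, AnalyticOnNhd ℝ (g j) U) → ContDiffOn ℝ ∞ φ U →
        IsCompact {x ∈ U | ∀ j, 0 ≤ g j x} → (∀ x ∈ {x ∈ U | ∀ j, 0 ≤ g j x}, 0 < φ x) →
        μ {x ∈ U | (∀ j, 0 ≤ g j x) ∧ f x = 0} = 0 →
        ∀ x ∈ {x ∈ U | ∀ j, 0 ≤ g j x}, f x = 0 → ∃ W : Set E, IsOpen W ∧ x ∈ W ∧
          ∃ (ι : Type) (_ : Fintype ι) (κ w : ι → Fin (Module.finrank ℝ E) → ℕ)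
            (a ψ : ι → (Fin (Module.finrank ℝ E) → ℝ) → ℝ)
            (P : ι → (Fin (Module.finrank ℝ E) → ℝ) → E),
            (∀ k, κ k ≠ 0) ∧ (∀ k j, 0 < w k j) ∧ (∀ k, Continuous (a k)) ∧ (∀ k y, 0 < a k y) ∧
            (∀ k, Continuous (ψ k)) ∧
            (∀ k, ∀ y ∈ Icc (0 : Fin (Module.finrank ℝ E) → ℝ) 1, 0 ≤ ψ k y) ∧
            (∀ k, 0 < ψ k 0) ∧ (∀ k, Continuous (P k)) ∧ (∀ k, P k 0 = x) ∧
            ∀ σ : E → ℝ, Continuous σ → tsupport σ ⊆ W → (∀ z, 0 ≤ σ z) → ∀ t : ℝ, 0 < t →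
              ∫ z in {z ∈ {x ∈ U | ∀ j, 0 ≤ g j x} | |f z| ≤ t}, σ z * φ z ∂μ =
                ∑ k, ∫ y in {y : Fin (Module.finrank ℝ E) → ℝ | a k y * ∏ j, y j ^ κ k j ≤ t},
                  σ (P k y) * ψ k y ∂(Measure.pi fun j => powMeasure (w k j : ℝ))) :
    WilsonPartitionRegularVariation :=
  wilsonPartitionRegularVariation_of_laplaceAsymptotics
    (laplaceAsymptotics_of_monomialization (monomialization_of_local hH))

end Local

end Literature.MathematicalPhysics.QuantumFieldTheory

end
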